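import Mathlib

/-!
# Crux-ideate k4 g26 — `BECModePrice.ModePriceHardCore` (stmt-AtomisticToContinuum-18513)

No crux idea card is filed by this seat (record saturated, see MEMO-r26-k4 / NOTES.md).
This file lands ONE concrete datum the route's heuristics rest on and which so far was only
asserted numerically (route file NUMBERS / CHEAPEST FALSIFIER (i); Disproof.lean §D; MEMO-r6-k4 W1):

**Bogoliubov half-softening price.** In the exactly solvable two-mode (`su(1,1)`) quadratic model,
softening the kinetic energy of ONE mode `k` by the factor `½` lowers the ground-state energy by
`B(k) = μ · b(ε_k/μ)` with `b(x) = √(x²+2x) − √(9x²/16 + 3x/2) − x/4` (`ħ = 2m = 1`, `μ = 8πρa`).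
We prove the real inequality `b(x) ≤ 1/20` for all `x ≥ 0` (numerically `sup b = 0.04932` at
`x ≈ 0.478`), i.e. `sup_k B(k) ≤ μ/20`, and its homogeneous form. This is the W1 witness of
MEMO-r6-k4 §3a (a `T3-plan-only`-grade toy rung: the softened quasi-particle energies stay positive),
kernel-checked; it is NOT a statement about the many-body problem.

Certificate: with `L(x) = 3x²/8 + 19x/40 − 1/400` and `M(x) = (1/10 + x/2)·√(9x²/16+3x/2)`,
`b(x) ≤ 1/20 ⟸ L ≤ M`, and `M² − L² = t·((3/40)(t − 67/150)² + 8333/4800000) + 12629/160000000`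
with `t = x − 1/200` (the quartic terms cancel), while `L < 0` for `x ≤ 1/200`.
-/

namespace Summit.AtomisticToContinuum.BoseEinsteinCondensation.Cruxes.ModePriceHardCore.IdeatorK4g26

/-- The dimensionless Bogoliubov half-softening price function `b(x)`, `x = ε_k/μ`. -/
noncomputable def bogPrice (x : ℝ) : ℝ :=
  Real.sqrt (x ^ 2 + 2 * x) - Real.sqrt (9 * x ^ 2 / 16 + 3 * x / 2) - x / 4

/-- **W1 (MEMO-r6-k4 §3a), kernel-checked:** `b(x) ≤ 1/20` for every `x ≥ 0`
(numerical supremum `0.04932` at `x ≈ 0.478`). -/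
theorem bogPrice_le (x : ℝ) (hx : 0 ≤ x) : bogPrice x ≤ 1 / 20 := by
  unfold bogPrice
  set A := Real.sqrt (x ^ 2 + 2 * x) with hAdef
  set B := Real.sqrt (9 * x ^ 2 / 16 + 3 * x / 2) with hBdef
  have hA0 : 0 ≤ A := Real.sqrt_nonneg _
  have hB0 : 0 ≤ B := Real.sqrt_nonneg _
  have hB2 : B ^ 2 = 9 * x ^ 2 / 16 + 3 * x / 2 := by
    rw [hBdef, Real.sq_sqrt]; positivity
  have hR0 : 0 ≤ 1 / 20 + x / 4 + B := by positivity
  -- it suffices to compare squares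
  have key : x ^ 2 + 2 * x ≤ (1 / 20 + x / 4 + B) ^ 2 := by
    rcases le_or_gt x (1 / 200) with h | h
    · -- here L(x) < 0 and the cross term is nonnegative
      have hcross : 0 ≤ (1 / 20 + x / 4) * B := by positivity
      nlinarith [hB2, hcross]
    · -- here L(x) ≤ M(x) via M² − L² = P(x) ≥ 0
      have hM0 : 0 ≤ (1 / 10 + x / 2) * B := by positivity
      have hid : ((1 / 10 + x / 2) * B) ^ 2 - (3 * x ^ 2 / 8 + 19 * x / 40 - 1 / 400) ^ 2
          = (x - 1 / 200) * ((3 / 40) * (x - 1 / 200 - 67 / 150) ^ 2 + 8333 / 4800000)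
            + 12629 / 160000000 := by
        rw [mul_pow, hB2]; ring
      have hP : 0 ≤ ((1 / 10 + x / 2) * B) ^ 2 - (3 * x ^ 2 / 8 + 19 * x / 40 - 1 / 400) ^ 2 := by
        rw [hid]
        have ht : 0 ≤ x - 1 / 200 := by linarith
        positivity
      have hLM : 3 * x ^ 2 / 8 + 19 * x / 40 - 1 / 400 ≤ (1 / 10 + x / 2) * B := by
        by_contra hc
        push Not at hc
        nlinarith [hM0, hc, hP]
      nlinarith [hB2, hLM]
  have hA_le : A ≤ 1 / 20 + x / 4 + B := by
    rw [hAdef]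
    calc Real.sqrt (x ^ 2 + 2 * x) ≤ Real.sqrt ((1 / 20 + x / 4 + B) ^ 2) := Real.sqrt_le_sqrt key
      _ = 1 / 20 + x / 4 + B := Real.sqrt_sq hR0
  linarith

/-- Homogeneous form: for `μ > 0` and `ε ≥ 0`,
`√(ε² + 2με) − √(9ε²/16 + 3με/2) − ε/4 ≤ μ/20` (the two-mode Bogoliubov half-softening price of a
mode of kinetic energy `ε` at chemical potential `μ` is at most `μ/20`). -/
theorem bogPrice_le_scaled (μ ε : ℝ) (hμ : 0 < μ) (hε : 0 ≤ ε) :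
    Real.sqrt (ε ^ 2 + 2 * μ * ε) - Real.sqrt (9 * ε ^ 2 / 16 + 3 * μ * ε / 2) - ε / 4 ≤ μ / 20 := by
  have hx : 0 ≤ ε / μ := div_nonneg hε hμ.le
  have hb := bogPrice_le (ε / μ) hx
  unfold bogPrice at hb
  have hμ0 : 0 ≤ μ := hμ.le
  have h1 : Real.sqrt (ε ^ 2 + 2 * μ * ε) = μ * Real.sqrt ((ε / μ) ^ 2 + 2 * (ε / μ)) := by
    rw [← Real.sqrt_sq hμ0, ← Real.sqrt_mul (sq_nonneg μ), Real.sqrt_sq hμ0]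
    congr 1
    field_simp
  have h2 : Real.sqrt (9 * ε ^ 2 / 16 + 3 * μ * ε / 2)
      = μ * Real.sqrt (9 * (ε / μ) ^ 2 / 16 + 3 * (ε / μ) / 2) := by
    rw [← Real.sqrt_sq hμ0, ← Real.sqrt_mul (sq_nonneg μ), Real.sqrt_sq hμ0]
    congr 1
    field_simp
  rw [h1, h2]
  have h3 : ε / 4 = μ * ((ε / μ) / 4) := by field_simp
  rw [h3]
  have := mul_le_mul_of_nonneg_left hb hμ0
  nlinarith [this]

end Summit.AtomisticToContinuum.BoseEinsteinCondensation.Cruxes.ModePriceHardCore.IdeatorK4g26
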